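import Summits.CriticalPhenomena.PercolationContinuityZ3.Theorems.Transplant.SkelPhiParaRunFrame
import Summits.CriticalPhenomena.PercolationContinuityZ3.Theorems.Transplant.TwoAxisParaCellsSkel
import HarnessLib

/-!
# N1 (the `{±1}` node), LEVEL 1: COARSE CONTAINMENT OF RUNS — reading the run coordinates `(Δα, Δβ′)` of a vertex relative to a run origin `c₀` into
# hp-8's coarse cell skeleton `Skelφ.coarseSkel φ t A n h vα vβ c s₀ s₁ D` (`ρ = ⌊(c·λ + s)/D⌋`, `λ = adj[A u, A v]·(φ − φ t)`): the exact identities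
# `Δλ₁ = A·Δβ′`, `n·Δλ₀ = A·(m·Δα − vα·Δβ′)` (`m = n vβ − h vα`), interval bounds for `Δλ`, and the resulting bounds for `Δρ` — so that a run region
# (an `(α, ⌊β′/(n+|h|)⌋)`-box of the run frames) is placed inside a coarse box of the cell complex (hp-8 NEG-NODE-F-SCOPE §10.4 (I2), "coarse_containment_run")

builds on p205010 (kernel theorem, internal audit signed; external expert review pending) — nothing in this file uses p205010; nothing here is a
claim about the open node `SamePDropOfSkeletonNeg`.
Lane `prim-bschramm`, seat `prim-bschramm-p1` (gen 11; NEG-SCOPE v1.1 §5 / P5-R2 / hp-8 D1: runs in run frames, cells in `coarseSkel`, joined per region);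
helper file (`--supports stmt-CriticalPhenomena-4575 --as helper`).  Sign-agnostic: the bounds are on the plain offsets `Δα = relCoord φ c₀ 0 g`,
`Δβ′ = shearCoord φ c₀ n h g`; a consumer holding run-frame bounds (`σΔα`, `⌊σΔβ′/(n+|h|)⌋`) converts with `shearCoord_bounds_of_floor_bounds`.
* §1 `coarse_sub_coarse_bounds` (`L ≤ x − y ≤ U ⇒ ⌊cL/D⌋ ≤ ρ x − ρ y ≤ ⌊cU/D⌋ + 1`), `shearCoord_bounds_of_floor_bounds` (floored bounds ⇒ `β′` bounds);
* §2 the identities **`lam1_sub_origin`** (`λ₁(g) − λ₁(c₀) = A·Δβ′`), **`mul_lam0_sub_origin`** (`n·(λ₀(g) − λ₀(c₀)) = A·(m·Δα − vα·Δβ′)`);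
* §3 **`lam1_sub_bounds`**, **`lam0_sub_bounds`** (`a₁ ≤ Δα ≤ a₂`, `|Δβ′| ≤ B`, `0 ≤ A`, `0 ≤ m`, `1 ≤ n` ⇒ `⌊A(m a₁ − |vα| B)/n⌋ ≤ Δλ₀ ≤ ⌊A(m a₂ + |vα| B)/n⌋`);
* §4 **`coarseSkel_one_sub_bounds`**, **`coarseSkel_zero_sub_bounds`** (the `Δρ` intervals), `abs_coarseSkel_one_sub_le` (symmetric form via hp-8's `abs_coarse_sub_le`).
[cite: MartineauTassion2017, §4.1 (the lattice z₁u + z₂v), §4.3] [cite: KozmaNitzan2024, §4 Lemma 11 (p. 22: the run inside its slab)]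
-/

noncomputable section

namespace Summit.CriticalPhenomena.PercolationContinuityZ3.Theorems.Transplant

namespace Skelφ

open Literature.Probability.Percolation Literature.Probability.LatticeModels SimpleGraph
open TwoAxis.Para (coarse lam0 lam1 modulus)

variable {V : Type} {G : SimpleGraph V} {φ : V → Site 2}

/-! ## §1 Floor arithmetic -/

/-- **One-sided coarse differences**: `L ≤ x − y ≤ U` gives `⌊cL/D⌋ ≤ ρ x − ρ y ≤ ⌊cU/D⌋ + 1` for `ρ t = ⌊(c t + s)/D⌋` (`0 ≤ c`, `0 < D`). [folklore] -/
theorem coarse_sub_coarse_bounds {c s D x y L U : ℤ} (hc : 0 ≤ c) (hD : 0 < D) (hL : L ≤ x - y) (hU : x - y ≤ U) :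
    (c * L) / D ≤ coarse c s D x - coarse c s D y ∧ coarse c s D x - coarse c s D y ≤ (c * U) / D + 1 := by
  unfold coarse
  have e : (c * x + s) - (c * y + s) = c * (x - y) := by ring
  refine ⟨le_ediv_sub_ediv hD ?_, ediv_sub_ediv_le_add_one hD ?_⟩
  · rw [e]; exact mul_le_mul_of_nonneg_left hL hc
  · rw [e]; exact mul_le_mul_of_nonneg_left hU hc

/-- **Floored bounds give bounds**: `b₁ ≤ ⌊x/C⌋ ≤ b₂` (`0 < C`) gives `C·b₁ ≤ x ≤ C·b₂ + C − 1`. [folklore] -/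
theorem bounds_of_floor_bounds {C x b₁ b₂ : ℤ} (hC : 0 < C) (h1 : b₁ ≤ x / C) (h2 : x / C ≤ b₂) : C * b₁ ≤ x ∧ x ≤ C * b₂ + C - 1 := by
  have hd := Int.mul_ediv_add_emod x C
  have hr0 := Int.emod_nonneg x hC.ne'
  have hr1 := Int.emod_lt_of_pos x hC
  constructor <;> nlinarith

/-- The run frame's floored transverse coordinate read back: `b₁ ≤ ⌊σβ′/(n+|h|)⌋ ≤ b₂` gives `(n+|h|)·b₁ ≤ σβ′ ≤ (n+|h|)·b₂ + (n+|h|) − 1`. [folklore] -/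
theorem shearCoord_bounds_of_floor_bounds {n : ℕ} (hn : 1 ≤ n) (c₀ : V) (h σ : ℤ) (g : V) {b₁ b₂ : ℤ}
    (h1 : b₁ ≤ (σ * shearCoord φ c₀ n h g) / (shearUnit n h : ℤ)) (h2 : (σ * shearCoord φ c₀ n h g) / (shearUnit n h : ℤ) ≤ b₂) :
    (shearUnit n h : ℤ) * b₁ ≤ σ * shearCoord φ c₀ n h g ∧ σ * shearCoord φ c₀ n h g ≤ (shearUnit n h : ℤ) * b₂ + shearUnit n h - 1 :=
  bounds_of_floor_bounds (shearUnit_pos hn h) h1 h2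

/-! ## §2 The dual coordinates relative to a run origin -/

/-- **`Δλ₁ = A·Δβ′`**: the second dual coordinate of `g` minus that of the run origin `c₀` (both about the cell base vertex `t`) is `A` times the sheared
coordinate of `g` about `c₀`. [cite: MartineauTassion2017, §4.1] -/
theorem lam1_sub_origin (A : ℤ) (n : ℕ) (h : ℤ) (t c₀ g : V) :
    lam1 A n h (relφ φ t g) - lam1 A n h (relφ φ t c₀) = A * shearCoord φ c₀ n h g := by
  simp only [TwoAxis.Para.lam1, TwoAxis.Para.bp, relφ_apply, shearCoord_apply]; ring

/-- **`n·Δλ₀ = A·(m·Δα − vα·Δβ′)`** (`m = n vβ − h vα`): the first dual coordinate read through the run coordinates. [cite: MartineauTassion2017, §4.1] -/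
theorem mul_lam0_sub_origin (A : ℤ) (n : ℕ) (h vα vβ : ℤ) (t c₀ g : V) :
    (n : ℤ) * (lam0 A vα vβ (relφ φ t g) - lam0 A vα vβ (relφ φ t c₀)) =
      A * (modulus n h vα vβ * relCoord φ c₀ 0 g - vα * shearCoord φ c₀ n h g) := by
  simp only [TwoAxis.Para.lam0, TwoAxis.Para.modulus, relφ_apply, relCoord_apply, shearCoord_apply]; ring

/-! ## §3 Interval bounds for `Δλ` -/

/-- **Bounds for `Δλ₁`** from bounds on `Δβ′` (`0 ≤ A`). [folklore] -/
theorem lam1_sub_bounds {A : ℤ} (hA : 0 ≤ A) (n : ℕ) (h : ℤ) (t c₀ g : V) {b₁ b₂ : ℤ}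
    (h1 : b₁ ≤ shearCoord φ c₀ n h g) (h2 : shearCoord φ c₀ n h g ≤ b₂) :
    A * b₁ ≤ lam1 A n h (relφ φ t g) - lam1 A n h (relφ φ t c₀) ∧ lam1 A n h (relφ φ t g) - lam1 A n h (relφ φ t c₀) ≤ A * b₂ := by
  rw [lam1_sub_origin]
  exact ⟨mul_le_mul_of_nonneg_left h1 hA, mul_le_mul_of_nonneg_left h2 hA⟩

/-- **Bounds for `Δλ₀`** from `a₁ ≤ Δα ≤ a₂`, `|Δβ′| ≤ B` (`0 ≤ A`, `0 ≤ m`, `1 ≤ n`): `⌊A(m a₁ − |vα| B)/n⌋ ≤ Δλ₀ ≤ ⌊A(m a₂ + |vα| B)/n⌋`. [folklore] -/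
theorem lam0_sub_bounds {A : ℤ} (hA : 0 ≤ A) {n : ℕ} (hn : 1 ≤ n) {h vα vβ : ℤ} (hm : 0 ≤ modulus n h vα vβ) (t c₀ g : V) {a₁ a₂ B : ℤ}
    (ha1 : a₁ ≤ relCoord φ c₀ 0 g) (ha2 : relCoord φ c₀ 0 g ≤ a₂) (hB : |shearCoord φ c₀ n h g| ≤ B) :
    A * (modulus n h vα vβ * a₁ - |vα| * B) / n ≤ lam0 A vα vβ (relφ φ t g) - lam0 A vα vβ (relφ φ t c₀) ∧
      lam0 A vα vβ (relφ φ t g) - lam0 A vα vβ (relφ φ t c₀) ≤ A * (modulus n h vα vβ * a₂ + |vα| * B) / n := by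
  have hn0 : (0 : ℤ) < n := by exact_mod_cast hn
  have e := mul_lam0_sub_origin (φ := φ) A n h vα vβ t c₀ g
  set Δ := lam0 A vα vβ (relφ φ t g) - lam0 A vα vβ (relφ φ t c₀) with hΔ
  have hv : |vα * shearCoord φ c₀ n h g| ≤ |vα| * B := by
    rw [abs_mul]; exact mul_le_mul_of_nonneg_left hB (abs_nonneg _)
  rw [abs_le] at hv
  have hlo : A * (modulus n h vα vβ * a₁ - |vα| * B) ≤ (n : ℤ) * Δ := by
    rw [e]; refine mul_le_mul_of_nonneg_left ?_ hA; nlinarith [hv.2]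
  have hhi : (n : ℤ) * Δ ≤ A * (modulus n h vα vβ * a₂ + |vα| * B) := by
    rw [e]; refine mul_le_mul_of_nonneg_left ?_ hA; nlinarith [hv.1]
  constructor
  · -- `⌊L/n⌋ ≤ Δ` from `L ≤ n Δ`
    have h1 : A * (modulus n h vα vβ * a₁ - |vα| * B) / n ≤ (n : ℤ) * Δ / n := Int.ediv_le_ediv hn0 hlo
    have h2 : (n : ℤ) * Δ / n = Δ := by rw [mul_comm]; exact Int.mul_ediv_cancel Δ hn0.ne'
    rw [h2] at h1; exact h1
  · exact Int.le_ediv_of_mul_le hn0 (by rw [mul_comm]; exact hhi)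

/-! ## §4 The coarse coordinates of a run vertex -/

/-- **`Δρ₁` of a run vertex**: `b₁ ≤ Δβ′ ≤ b₂` (`0 ≤ A`, `0 ≤ c`, `0 < D`) gives `⌊c A b₁/D⌋ ≤ ρ₁(g) − ρ₁(c₀) ≤ ⌊c A b₂/D⌋ + 1`.
[cite: MartineauTassion2017, §4.3] [cite: KozmaNitzan2024, §4 Lemma 11 (p. 22)] -/
theorem coarseSkel_one_sub_bounds {A : ℤ} (hA : 0 ≤ A) (n : ℕ) (h vα vβ : ℤ) {c s₀ s₁ D : ℤ} (hc : 0 ≤ c) (hD : 0 < D) (t c₀ g : V) {b₁ b₂ : ℤ}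
    (h1 : b₁ ≤ shearCoord φ c₀ n h g) (h2 : shearCoord φ c₀ n h g ≤ b₂) :
    (c * (A * b₁)) / D ≤ coarseSkel φ t A n h vα vβ c s₀ s₁ D g 1 - coarseSkel φ t A n h vα vβ c s₀ s₁ D c₀ 1 ∧
      coarseSkel φ t A n h vα vβ c s₀ s₁ D g 1 - coarseSkel φ t A n h vα vβ c s₀ s₁ D c₀ 1 ≤ (c * (A * b₂)) / D + 1 := by
  obtain ⟨hl, hu⟩ := lam1_sub_bounds hA n h t c₀ g h1 h2
  have hcs : ∀ w : V, coarseSkel φ t A n h vα vβ c s₀ s₁ D w 1 = coarse c s₁ D (lam1 A n h (relφ φ t w)) := fun w => rfl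
  rw [hcs, hcs]
  exact coarse_sub_coarse_bounds hc hD hl hu

/-- **`Δρ₀` of a run vertex**: `a₁ ≤ Δα ≤ a₂`, `|Δβ′| ≤ B` (`0 ≤ A`, `0 ≤ m`, `1 ≤ n`, `0 ≤ c`, `0 < D`) give
`⌊c·⌊A(m a₁ − |vα|B)/n⌋/D⌋ ≤ ρ₀(g) − ρ₀(c₀) ≤ ⌊c·⌊A(m a₂ + |vα|B)/n⌋/D⌋ + 1`. [cite: MartineauTassion2017, §4.3] [cite: KozmaNitzan2024, §4 Lemma 11 (p. 22)] -/
theorem coarseSkel_zero_sub_bounds {A : ℤ} (hA : 0 ≤ A) {n : ℕ} (hn : 1 ≤ n) {h vα vβ : ℤ} (hm : 0 ≤ modulus n h vα vβ) {c s₀ s₁ D : ℤ} (hc : 0 ≤ c)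
    (hD : 0 < D) (t c₀ g : V) {a₁ a₂ B : ℤ} (ha1 : a₁ ≤ relCoord φ c₀ 0 g) (ha2 : relCoord φ c₀ 0 g ≤ a₂) (hB : |shearCoord φ c₀ n h g| ≤ B) :
    (c * (A * (modulus n h vα vβ * a₁ - |vα| * B) / n)) / D ≤
        coarseSkel φ t A n h vα vβ c s₀ s₁ D g 0 - coarseSkel φ t A n h vα vβ c s₀ s₁ D c₀ 0 ∧
      coarseSkel φ t A n h vα vβ c s₀ s₁ D g 0 - coarseSkel φ t A n h vα vβ c s₀ s₁ D c₀ 0 ≤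
        (c * (A * (modulus n h vα vβ * a₂ + |vα| * B) / n)) / D + 1 := by
  obtain ⟨hl, hu⟩ := lam0_sub_bounds hA hn hm t c₀ g ha1 ha2 hB
  have hcs : ∀ w : V, coarseSkel φ t A n h vα vβ c s₀ s₁ D w 0 = coarse c s₀ D (lam0 A vα vβ (relφ φ t w)) := fun w => rfl
  rw [hcs, hcs]
  exact coarse_sub_coarse_bounds hc hD hl hu

/-- **Symmetric form for `ρ₁`**: `|Δβ′| ≤ B` and `c·|A|·B ≤ k·D` give `|ρ₁(g) − ρ₁(c₀)| ≤ k` (hp-8's `abs_coarse_sub_le` on `Δλ₁ = A Δβ′`).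
[cite: KozmaNitzan2024, §4 Lemma 10 Step IV] -/
theorem abs_coarseSkel_one_sub_le (A : ℤ) (n : ℕ) (h vα vβ : ℤ) {c s₀ s₁ D k B : ℤ} (hc : 0 ≤ c) (hD : 0 < D) (hk : c * (|A| * B) ≤ k * D)
    (t c₀ g : V) (hB : |shearCoord φ c₀ n h g| ≤ B) :
    |coarseSkel φ t A n h vα vβ c s₀ s₁ D g 1 - coarseSkel φ t A n h vα vβ c s₀ s₁ D c₀ 1| ≤ k := by
  have hcs : ∀ w : V, coarseSkel φ t A n h vα vβ c s₀ s₁ D w 1 = coarse c s₁ D (lam1 A n h (relφ φ t w)) := fun w => rfl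
  rw [hcs, hcs]
  refine TwoAxis.Para.abs_coarse_sub_le hc hD hk ?_
  rw [lam1_sub_origin, abs_mul]
  exact mul_le_mul_of_nonneg_left hB (abs_nonneg A)

end Skelφ

end Summit.CriticalPhenomena.PercolationContinuityZ3.Theorems.Transplant

end
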